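import Literature.Geometry.Kaehler.PoincareLemmaStarConvex
import HarnessLib

/-!
# The radial homotopy operator commutes with linear maps (stub `stub_coneOperator_comp_clm`)

Crux `HeckeEigenvalueField` (stmt-Langlands-13632), line `Sketch`.  For continuous linear
`A : E → E'`, `T : F → F'` and forms `ω` on `E'`, `ω₀` on `E` with `A^* ω = T ∘ ω₀` on a set `X`
star-shaped at `x₀` (`ω ∘ A` and `ω₀` continuous on `X`), the radial primitives
`K_{x₀} β x = ∫₀¹ t^k • ι_{x - x₀} β (x₀ + t (x - x₀)) dt` of
`Literature.Geometry.Kaehler.PoincareLemmaFlat` centred at `A x₀` and at `x₀` correspond in the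
same way: `A^* (K_{A x₀} ω) (A x) = T ∘ K_{x₀} ω₀ x` for `x ∈ X`.  The segment `[x₀, x] ⊆ X` is
mapped by `A` onto `[A x₀, A x]`, `(ι_{A w} (ω (A y))) ∘ ∧A = ι_w (A^* ω (A y))`
(`ContinuousAlternatingMap.curryLeft_compContinuousLinearMap`), and `A^*`, `T ∘ -` commute with the
interval integral (`ContinuousLinearMap.intervalIntegral_comp_comm`).

The continuity of `ω ∘ A` on `X` cannot be dropped: the relation `A^* ω = T ∘ ω₀` only controls
the values of `ω (A y)` on tuples of vectors in the range of `A`, and if the remaining components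
of `t ↦ t^k • ι_{A (x - x₀)} ω (A (x₀ + t (x - x₀)))` fail to be integrable on `[0, 1]` the Bochner
integral `K_{A x₀} ω (A x)` is `0` by convention while `T ∘ K_{x₀} ω₀ x` need not be.

## References

* R. Bott, L. W. Tu, *Differential Forms in Algebraic Topology* (1982), §I.4. [BottTu1982Forms]
* J. L. Dupont, Topology 15 (1976), §1–2. [Dupont1976]
-/

set_option linter.dupNamespace false -- project-wide: `Summit.Langlands.Langlands` is the mandated namespace

noncomputable section

namespace Summit.Langlands.Langlands.Theorems.HeckeEigenvalueField.Res

open Literature.Geometry.Kaehler Set MeasureTheory intervalIntegral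

/-- The points `x₀ + t (x - x₀)`, `t ∈ [0, 1]`, of the segment from the centre `x₀` of a
star-shaped set `X` to a point `x ∈ X` lie in `X`. [folklore] -/
theorem coneOpEquiv_mapsTo_segment {E : Type*} [AddCommGroup E] [Module ℝ E] {X : Set E}
    {x₀ x : E} (hX : StarConvex ℝ x₀ X) (hx : x ∈ X) :
    MapsTo (fun t : ℝ => x₀ + t • (x - x₀)) (Icc 0 1) X :=
  fun _ ht => hX.add_smul_sub_mem hx ht.1 ht.2

/-- `t ↦ t^k • ι_w (γ t)` is continuous on `[0, 1]` for a family of forms `γ` continuous on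
`[0, 1]` (insertion `ι` is a bounded bilinear map). [folklore] -/
theorem coneOpEquiv_continuousOn_smul_curryLeft {E : Type*} [NormedAddCommGroup E]
    [NormedSpace ℝ E] {F : Type*} [NormedAddCommGroup F] [NormedSpace ℝ F] (k : ℕ)
    {γ : ℝ → E [⋀^Fin (k + 1)]→L[ℝ] F} (hγ : ContinuousOn γ (Icc 0 1)) (w : E) :
    ContinuousOn (fun t : ℝ => (t ^ k) • (γ t).curryLeft w) (Icc 0 1) := by
  have h2 : ContinuousOn (fun t : ℝ => ContinuousAlternatingMap.curryLeft (γ t)) (Icc 0 1) :=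
    (ContinuousAlternatingMap.curryLeftLI (𝕜 := ℝ) (E := E) (F := F)
      (n := k)).continuous.comp_continuousOn hγ
  have h3 : ContinuousOn (fun t : ℝ => (γ t).curryLeft w) (Icc 0 1) :=
    h2.clm_apply continuousOn_const
  have h4 : ContinuousOn (fun t : ℝ => t ^ k) (Icc 0 1) := (continuous_pow k).continuousOn
  exact h4.smul h3

/-- The integrand `t ↦ t^k • ι_{x - x₀} β (x₀ + t (x - x₀))` of the radial homotopy operator is
integrable on `[0, 1]` as soon as `β` is continuous on a set star-shaped at `x₀` containing `x`.
[folklore] -/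
theorem coneOpEquiv_intervalIntegrable_coneIntegrand {E : Type*} [NormedAddCommGroup E]
    [NormedSpace ℝ E] {F : Type*} [NormedAddCommGroup F] [NormedSpace ℝ F] {k : ℕ} {X : Set E}
    {x₀ : E} (hX : StarConvex ℝ x₀ X) {β : E → E [⋀^Fin (k + 1)]→L[ℝ] F} (hβ : ContinuousOn β X)
    {x : E} (hx : x ∈ X) :
    IntervalIntegrable (fun t : ℝ => coneIntegrand x₀ β (t, x)) volume 0 1 := by
  have hpath : Continuous fun t : ℝ => x₀ + t • (x - x₀) :=
    continuous_const.add (continuous_id.smul continuous_const)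
  have hβp : ContinuousOn (fun t : ℝ => β (x₀ + t • (x - x₀))) (Icc 0 1) :=
    hβ.comp hpath.continuousOn (coneOpEquiv_mapsTo_segment hX hx)
  exact (coneOpEquiv_continuousOn_smul_curryLeft k hβp (x - x₀)).intervalIntegrable_of_Icc
    zero_le_one

/-- Pointwise form of the equivariance: if `A^* η = T ∘ η₀`, then
`A^* (c • ι_{A w} η) = T ∘ (c • ι_w η₀)`. [folklore] -/
theorem coneOpEquiv_integrand_rel {E : Type*} [NormedAddCommGroup E] [NormedSpace ℝ E]
    {E' : Type*} [NormedAddCommGroup E'] [NormedSpace ℝ E']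
    {F : Type*} [NormedAddCommGroup F] [NormedSpace ℝ F]
    {F' : Type*} [NormedAddCommGroup F'] [NormedSpace ℝ F']
    {k : ℕ} (A : E →L[ℝ] E') (T : F →L[ℝ] F') {η : E' [⋀^Fin (k + 1)]→L[ℝ] F'}
    {η₀ : E [⋀^Fin (k + 1)]→L[ℝ] F}
    (h : η.compContinuousLinearMap A = T.compContinuousAlternatingMap η₀) (c : ℝ) (w : E) :
    (c • η.curryLeft (A w)).compContinuousLinearMap A =
      T.compContinuousAlternatingMap (c • η₀.curryLeft w) := by
  have h1 : (η.curryLeft (A w)).compContinuousLinearMap A =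
      T.compContinuousAlternatingMap (η₀.curryLeft w) := by
    rw [← ContinuousAlternatingMap.curryLeft_compContinuousLinearMap, h,
      ContinuousAlternatingMap.curryLeft_compContinuousAlternatingMap]
  ext v
  have hv := congrArg (fun f : E [⋀^Fin k]→L[ℝ] F' => c • f v) h1
  simpa using hv

/-- **Stub R-EQUIV — the radial homotopy operator commutes with linear maps ON THE NOSE.**  For
continuous linear `A : E → E'`, `T : F → F'` and forms `ω` on `E'`, `ω₀` on `E` with `A^* ω = T ∘ ω₀`
on a set `X` star-shaped at `x₀` (`ω ∘ A` and `ω₀` continuous on `X`), the radial primitives centred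
at `A x₀` and `x₀` correspond in the same way: `A^*(K_{A x₀} ω) = T ∘ K_{x₀} ω₀` on `X` (the segment
`[x₀, x] ⊆ X` is mapped onto `[A x₀, A x]`, `ι_{A(x - x₀)}(ω ∘ A) ∘ ∧A = (A^*ω).curryLeft (x - x₀)`,
and `A^*`, `T ∘ -` commute with the integral).  With `A = (H ↦ γ H γᴴ)`, `T = ρ(γ)` this is the
`Γ`-equivariance of the staircase primitives.
[cite: BottTu1982Forms, §I.4] [cite: Dupont1976, §1–2] -/
theorem stub_coneOperator_comp_clm
    {E : Type*} [NormedAddCommGroup E] [NormedSpace ℝ E]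
    {E' : Type*} [NormedAddCommGroup E'] [NormedSpace ℝ E']
    {F : Type*} [NormedAddCommGroup F] [NormedSpace ℝ F] [CompleteSpace F]
    {F' : Type*} [NormedAddCommGroup F'] [NormedSpace ℝ F'] [CompleteSpace F']
    {k : ℕ} (A : E →L[ℝ] E') (T : F →L[ℝ] F') {X : Set E} {x₀ : E} (hX : StarConvex ℝ x₀ X)
    (ω : E' → E' [⋀^Fin (k + 1)]→L[ℝ] F') (ω₀ : E → E [⋀^Fin (k + 1)]→L[ℝ] F)
    (hω : ContinuousOn (fun y => ω (A y)) X) (hω₀ : ContinuousOn ω₀ X)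
    (hrel : ∀ y ∈ X, (ω (A y)).compContinuousLinearMap A = T.compContinuousAlternatingMap (ω₀ y))
    {x : E} (hx : x ∈ X) :
    (coneOperator (A x₀) ω (A x)).compContinuousLinearMap A =
      T.compContinuousAlternatingMap (coneOperator x₀ ω₀ x) := by
  -- the segment `[A x₀, A x]` is the image of `[x₀, x]`
  have hA : ∀ t : ℝ, A x₀ + t • (A x - A x₀) = A (x₀ + t • (x - x₀)) := fun t => by
    rw [map_add, map_smul, map_sub]
  have hAw : A x - A x₀ = A (x - x₀) := (map_sub A x x₀).symm
  have hI : ∀ t : ℝ, coneIntegrand (A x₀) ω (t, A x) =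
      (t ^ k) • (ω (A (x₀ + t • (x - x₀)))).curryLeft (A (x - x₀)) := fun t => by
    rw [coneIntegrand, hA, hAw]
  -- integrability of both integrands on `[0, 1]`
  have hi₀ : IntervalIntegrable (fun t : ℝ => coneIntegrand x₀ ω₀ (t, x)) volume 0 1 :=
    coneOpEquiv_intervalIntegrable_coneIntegrand hX hω₀ hx
  have hi : IntervalIntegrable (fun t : ℝ => coneIntegrand (A x₀) ω (t, A x)) volume 0 1 := by
    have hpath : Continuous fun t : ℝ => x₀ + t • (x - x₀) :=
      continuous_const.add (continuous_id.smul continuous_const)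
    have hωp : ContinuousOn (fun t : ℝ => ω (A (x₀ + t • (x - x₀)))) (Icc 0 1) :=
      hω.comp hpath.continuousOn (coneOpEquiv_mapsTo_segment hX hx)
    have hc := coneOpEquiv_continuousOn_smul_curryLeft k hωp (A (x - x₀))
    simp only [hI]
    exact hc.intervalIntegrable_of_Icc zero_le_one
  -- pull `A^*` and `T ∘ -` through the integrals
  have hL : (coneOperator (A x₀) ω (A x)).compContinuousLinearMap A =
      ∫ t in (0 : ℝ)..1, (coneIntegrand (A x₀) ω (t, A x)).compContinuousLinearMap A := by
    have h := (ContinuousAlternatingMap.compContinuousLinearMapCLM (ι := Fin k) (F := F') A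
      ).intervalIntegral_comp_comm hi
    simp only [ContinuousAlternatingMap.compContinuousLinearMapCLM_apply] at h
    rw [coneOperator, h]
  have hR : T.compContinuousAlternatingMap (coneOperator x₀ ω₀ x) =
      ∫ t in (0 : ℝ)..1, T.compContinuousAlternatingMap (coneIntegrand x₀ ω₀ (t, x)) := by
    have h := (ContinuousLinearMap.compContinuousAlternatingMapCLM ℝ E F F' (Fin k) T
      ).intervalIntegral_comp_comm hi₀
    rw [coneOperator]
    exact h.symm
  rw [hL, hR]
  refine intervalIntegral.integral_congr fun t ht => ?_
  rw [uIcc_of_le zero_le_one] at ht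
  rw [hI, coneIntegrand]
  exact coneOpEquiv_integrand_rel A T (hrel _ (hX.add_smul_sub_mem hx ht.1 ht.2)) _ _

end Summit.Langlands.Langlands.Theorems.HeckeEigenvalueField.Res

end
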